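import Summits.HodgeConjecture.HodgeConjecture.Theses.PeriodsPolice
import HarnessLib

/-!
# Route `PeriodsPolice`, support `PermutingHodgeTensorsNormalisesMT` (stmt-HodgeConjecture-1203)

In the tree's Mumford–Tate vocabulary (`MT(H)` = stabilizer of the weight-`0`, type-`(0,0)` Hodge
tensors, Deligne 1982 Prop. 3.4): an automorphism `g` of `V` such that `g` and `g⁻¹` map the Hodge
tensors of every `T^{a,b} V` to Hodge tensors conjugates `MT(H)` into itself. Proof (card Lemma 1b):
for `h ∈ MT(H)` and a weight-`0` type-`(0,0)` Hodge tensor `t`, `g⁻¹ t` is one too, so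
`h (g⁻¹ t) = g⁻¹ t` and `(g h g⁻¹) t = g (g⁻¹ t) = t` (`mem_mumfordTateGroup_iff`,
`tensorSpaceAct_mul_apply`, `tensorSpaceAct_one`).
-/

set_option linter.dupNamespace false

namespace Summit.HodgeConjecture.HodgeConjecture.Theorems

open Literature.AlgebraicGeometry.Motives

/-- **Support item `PermutingHodgeTensorsNormalisesMT`** (stmt-HodgeConjecture-1203): automorphisms
permuting the Hodge tensors (together with their inverses) normalise the Mumford–Tate group.
[cite: Deligne1982HodgeCycles, I Prop. 3.1 and Prop. 3.4] [cite: Moonen2004MT, §4] -/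
theorem periodsPolice_permutingHodgeTensorsNormalisesMT_proof :
    Summit.HodgeConjecture.HodgeConjecture.Theses.PeriodsPolice.PermutingHodgeTensorsNormalisesMT := by
  intro V _ _ _ _ n H g _hg hginv h hh
  rw [HodgeStructure.mem_mumfordTateGroup_iff] at hh ⊢
  intro a b hab t ht
  have h1 : tensorSpaceAct h (tensorSpaceAct g⁻¹ t) = tensorSpaceAct g⁻¹ t :=
    hh a b hab _ (hginv a b 0 t ht)
  rw [tensorSpaceAct_mul_apply, tensorSpaceAct_mul_apply, h1, ← tensorSpaceAct_mul_apply,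
    mul_inv_cancel, tensorSpaceAct_one]
  rfl

end Summit.HodgeConjecture.HodgeConjecture.Theorems
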